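import Mathlib
import Summits.ValiantsHypothesis.ValiantsHypothesis.Theorems.NewtonUnitEquationsNewtonTauWeakCornerWords

/-!
# `NewtonTauWeak` (stmt-ValiantsHypothesis-5904), line `binomial-normal-form`, stub `fixedKCoincidence_t2_K3`:
# the Laurent frame — separated products as Laurent polynomials, weights of supports, initial exponents

Support file for the registered sub-stub `fixedKCoincidence_t2_K3` (FixedKCoincidence at `t = 2`, `K = 3`)
of the crux `Summit.ValiantsHypothesis.ValiantsHypothesis.Theses.NewtonUnitEquations.NewtonTauWeak`.

The corner model of `…CornerDefs.lean` (lead c2) describes the coefficient of a lattice point in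
`κ₁ Π_e U_e(X^{E_e}) + κ₂ Π_e W_e(X^{E_e})` as a FIBRE SUM over the word box.  To connect it with the actual
sum of three binomial products (flip identity, division by the lowest product) we realise the separated
products inside the ring of bivariate LAURENT polynomials `𝕃 = ℂ[ℤ²]` (`AddMonoidAlgebra ℂ (Fin 2 → ℤ)`):
`U_e(X^{E_e})` is `Polynomial.eval₂ singleZeroRingHom (single E_e 1) U_e`, and the separated product is their
product over `e`.  This file proves: the word expansion of a separated product and its coefficient formula
(`k2_sepProd_eq_sum`, `k2_coeff_sepProd` — the bridge to `fibreSum`), weights of supports of products and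
sums, and the calculus of `w`-INITIAL exponents (unique weight-minimal support point): invariance under a
unit-like factor (`k2_isInit_mul_unit`), under heavy perturbations (`k2_isInit_of_heavy`), shifts and scalars.

No definitions (the Laurent objects are written out; `wt`, `push`, `sepCoeff`, `box` are the corner-model
objects). [folklore]
-/

-- the namespace mandated for this Theorems file repeats the component `ValiantsHypothesis`
set_option linter.dupNamespace false

noncomputable section

open scoped BigOperators Polynomial
open AddMonoidAlgebra

namespace Summit.ValiantsHypothesis.ValiantsHypothesis.Theorems.NewtonTauWeakCorner

/-! ## §1 Word expansion of a separated product in the Laurent ring `ℂ[ℤ²]` -/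

/-- A univariate polynomial of degree `≤ D` pushed along a direction `E ∈ ℤ²`:
`P(X^E) = Σ_{i ≤ D} [s^i]P · X^{iE}` in `ℂ[ℤ²]`. [folklore] -/
theorem k2_eval₂_eq_sum (E : Fin 2 → ℤ) (P : ℂ[X]) {D : ℕ} (hP : P.natDegree ≤ D) :
    Polynomial.eval₂ (singleZeroRingHom (R := ℂ) (M := Fin 2 → ℤ)) (single E (1 : ℂ)) P
      = ∑ i ∈ Finset.range (D + 1), single ((i : ℤ) • E) (P.coeff i) := by
  rw [Polynomial.eval₂_eq_sum_range' _ (Nat.lt_succ_of_le hP)]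
  refine Finset.sum_congr rfl fun i _ => ?_
  rw [single_pow, one_pow]
  show single 0 (P.coeff i) * single (i • E) 1 = _
  rw [single_mul_single, zero_add, mul_one, natCast_zsmul]

/-- **Word expansion.** A separated product `Π_e U_e(X^{E_e})` with `deg U_e ≤ D` is the sum over the word box
`{0,…,D}^s` of `sepCoeff U n · X^{push E n}`. [folklore] -/
theorem k2_sepProd_eq_sum {s D : ℕ} (E : Fin s → Fin 2 → ℤ) (U : Fin s → ℂ[X])
    (hUD : ∀ e, (U e).natDegree ≤ D) :
    (∏ e, Polynomial.eval₂ (singleZeroRingHom (R := ℂ) (M := Fin 2 → ℤ)) (single (E e) (1 : ℂ)) (U e))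
      = ∑ n ∈ box s D, single (push E n) (sepCoeff U n) := by
  have h : ∀ e, Polynomial.eval₂ (singleZeroRingHom (R := ℂ) (M := Fin 2 → ℤ)) (single (E e) (1 : ℂ)) (U e)
      = ∑ i ∈ Finset.range (D + 1), single ((i : ℤ) • E e) ((U e).coeff i) :=
    fun e => k2_eval₂_eq_sum (E e) (U e) (hUD e)
  simp_rw [h]
  rw [Finset.prod_univ_sum]
  refine Finset.sum_congr rfl fun n _ => ?_
  rw [prod_single]
  rfl

/-- **Coefficient formula (bridge to the fibre sums of the corner model).** The coefficient of `X^z` in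
`Π_e U_e(X^{E_e})` is the sum of `sepCoeff U n` over the words of the box pushing forward to `z`. [folklore] -/
theorem k2_coeff_sepProd {s D : ℕ} (E : Fin s → Fin 2 → ℤ) (U : Fin s → ℂ[X])
    (hUD : ∀ e, (U e).natDegree ≤ D) (z : Fin 2 → ℤ) :
    (∏ e, Polynomial.eval₂ (singleZeroRingHom (R := ℂ) (M := Fin 2 → ℤ)) (single (E e) (1 : ℂ)) (U e)).coeff z
      = ∑ n ∈ (box s D).filter (fun n => push E n = z), sepCoeff U n := by
  classical
  rw [k2_sepProd_eq_sum E U hUD, coeff_sum, Finsupp.finsetSum_apply, Finset.sum_filter]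
  refine Finset.sum_congr rfl fun n _ => ?_
  rw [coeff_single, Finsupp.single_apply]

/-- The weight of a pushed word is non-negative when all directions have positive weight, and vanishes only
for the empty word. [folklore] -/
theorem k2_wt_push_pos {s : ℕ} (E : Fin s → Fin 2 → ℤ) (w : Fin 2 → ℝ) (hw : ∀ e, 0 < wt w (E e))
    (n : Fin s → ℕ) : 0 ≤ wt w (push E n) ∧ (n ≠ 0 → 0 < wt w (push E n)) := by
  rw [wt_push]
  refine ⟨Finset.sum_nonneg fun e _ => mul_nonneg (Nat.cast_nonneg _) (hw e).le, fun hn => ?_⟩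
  obtain ⟨e, he⟩ : ∃ e, n e ≠ 0 := by
    by_contra h
    push Not at h
    exact hn (funext h)
  refine Finset.sum_pos' (fun e _ => mul_nonneg (Nat.cast_nonneg _) (hw e).le) ⟨e, Finset.mem_univ _, ?_⟩
  exact mul_pos (by exact_mod_cast Nat.pos_of_ne_zero he) (hw e)

/-- A support point of a separated product is the push-forward of a box word with nonzero separated
coefficient. [folklore] -/
theorem k2_exists_word_of_mem_support {s D : ℕ} (E : Fin s → Fin 2 → ℤ) (U : Fin s → ℂ[X])
    (hUD : ∀ e, (U e).natDegree ≤ D) {z : Fin 2 → ℤ}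
    (hz : z ∈ (∏ e, Polynomial.eval₂ (singleZeroRingHom (R := ℂ) (M := Fin 2 → ℤ)) (single (E e) (1 : ℂ))
      (U e)).coeff.support) :
    ∃ n ∈ box s D, push E n = z ∧ sepCoeff U n ≠ 0 := by
  classical
  rw [Finsupp.mem_support_iff, k2_coeff_sepProd E U hUD] at hz
  obtain ⟨n, hn, hne⟩ := Finset.exists_ne_zero_of_sum_ne_zero hz
  rw [Finset.mem_filter] at hn
  exact ⟨n, hn.1, hn.2, hne⟩

/-- Support points of a separated product have non-negative weight, positive except at the origin.
[folklore] -/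
theorem k2_wt_of_mem_support_sepProd {s D : ℕ} (E : Fin s → Fin 2 → ℤ) (w : Fin 2 → ℝ)
    (hw : ∀ e, 0 < wt w (E e)) (U : Fin s → ℂ[X]) (hUD : ∀ e, (U e).natDegree ≤ D) {z : Fin 2 → ℤ}
    (hz : z ∈ (∏ e, Polynomial.eval₂ (singleZeroRingHom (R := ℂ) (M := Fin 2 → ℤ)) (single (E e) (1 : ℂ))
      (U e)).coeff.support) :
    0 ≤ wt w z ∧ (z ≠ 0 → 0 < wt w z) := by
  obtain ⟨n, -, hpush, -⟩ := k2_exists_word_of_mem_support E U hUD hz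
  subst hpush
  refine ⟨(k2_wt_push_pos E w hw n).1, fun hz0 => (k2_wt_push_pos E w hw n).2 ?_⟩
  rintro rfl
  exact hz0 (push_zero E)

/-- The constant coefficient of a separated product of factors with constant term `1` is `1` (only the empty
word pushes to the origin). [folklore] -/
theorem k2_coeff_sepProd_zero {s D : ℕ} (E : Fin s → Fin 2 → ℤ) (w : Fin 2 → ℝ)
    (hw : ∀ e, 0 < wt w (E e)) (U : Fin s → ℂ[X]) (hU0 : ∀ e, (U e).coeff 0 = 1)
    (hUD : ∀ e, (U e).natDegree ≤ D) :
    (∏ e, Polynomial.eval₂ (singleZeroRingHom (R := ℂ) (M := Fin 2 → ℤ)) (single (E e) (1 : ℂ))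
      (U e)).coeff 0 = 1 := by
  classical
  rw [k2_coeff_sepProd E U hUD]
  have hfil : (box s D).filter (fun n => push E n = 0) = {0} := by
    ext n
    simp only [Finset.mem_filter, Finset.mem_singleton]
    constructor
    · rintro ⟨-, hn⟩
      by_contra hne
      have := (k2_wt_push_pos E w hw n).2 hne
      rw [hn, wt_zero] at this
      exact lt_irrefl _ this
    · rintro rfl
      refine ⟨?_, push_zero E⟩
      simp [box, Fintype.mem_piFinset]
  rw [hfil, Finset.sum_singleton]
  unfold sepCoeff
  exact Finset.prod_eq_one fun e _ => by simp [hU0]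

/-! ## §2 Weights of supports: products, sums, monomials -/

/-- Support of a product: every exponent of `f g` is a sum of exponents of `f` and `g`. [folklore] -/
theorem k2_exists_add_of_mem_support_mul {f g : AddMonoidAlgebra ℂ (Fin 2 → ℤ)} {u : Fin 2 → ℤ}
    (hu : u ∈ (f * g).coeff.support) : ∃ x ∈ f.coeff.support, ∃ y ∈ g.coeff.support, u = x + y := by
  classical
  have h := support_coeff_mul_subset f g hu
  rw [Finset.mem_add] at h
  obtain ⟨x, hx, y, hy, rfl⟩ := h
  exact ⟨x, hx, y, hy, rfl⟩

/-- Weight lower bounds multiply: if `supp f` weighs `≥ a` and `supp g` weighs `≥ b` then `supp (f g)` weighs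
`≥ a + b`. [folklore] -/
theorem k2_wtGE_mul (w : Fin 2 → ℝ) {f g : AddMonoidAlgebra ℂ (Fin 2 → ℤ)} {a b : ℝ}
    (hf : ∀ x ∈ f.coeff.support, a ≤ wt w x) (hg : ∀ y ∈ g.coeff.support, b ≤ wt w y) :
    ∀ u ∈ (f * g).coeff.support, a + b ≤ wt w u := by
  intro u hu
  obtain ⟨x, hx, y, hy, rfl⟩ := k2_exists_add_of_mem_support_mul hu
  rw [wt_add]
  exact add_le_add (hf x hx) (hg y hy)

/-- Weight lower bounds are preserved by sums. [folklore] -/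
theorem k2_wtGE_add (w : Fin 2 → ℝ) {f g : AddMonoidAlgebra ℂ (Fin 2 → ℤ)} {a : ℝ}
    (hf : ∀ x ∈ f.coeff.support, a ≤ wt w x) (hg : ∀ y ∈ g.coeff.support, a ≤ wt w y) :
    ∀ u ∈ (f + g).coeff.support, a ≤ wt w u := by
  intro u hu
  rw [coeff_add] at hu
  rcases Finset.mem_union.mp (Finsupp.support_add hu) with h | h
  · exact hf u h
  · exact hg u h

/-- Weight lower bounds are preserved by scalars. [folklore] -/
theorem k2_wtGE_smul (w : Fin 2 → ℝ) {f : AddMonoidAlgebra ℂ (Fin 2 → ℤ)} {a : ℝ} (κ : ℂ)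
    (hf : ∀ x ∈ f.coeff.support, a ≤ wt w x) :
    ∀ u ∈ (κ • f).coeff.support, a ≤ wt w u := by
  intro u hu
  rw [coeff_smul] at hu
  exact hf u (Finsupp.support_smul hu)

/-- Weight lower bounds are preserved by finite sums. [folklore] -/
theorem k2_wtGE_sum (w : Fin 2 → ℝ) {ι : Type*} (t : Finset ι) (f : ι → AddMonoidAlgebra ℂ (Fin 2 → ℤ))
    {a : ℝ} (hf : ∀ i ∈ t, ∀ x ∈ (f i).coeff.support, a ≤ wt w x) :
    ∀ u ∈ (∑ i ∈ t, f i).coeff.support, a ≤ wt w u := by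
  classical
  induction t using Finset.induction_on with
  | empty => intro u hu; simp at hu
  | insert i t hi ih =>
    rw [Finset.sum_insert hi]
    exact k2_wtGE_add w (hf i (Finset.mem_insert_self i t))
      (ih fun j hj => hf j (Finset.mem_insert_of_mem hj))

/-- Non-negative weights are preserved by finite products. [folklore] -/
theorem k2_wtGE_prod (w : Fin 2 → ℝ) {ι : Type*} (t : Finset ι) (f : ι → AddMonoidAlgebra ℂ (Fin 2 → ℤ))
    (hf : ∀ i ∈ t, ∀ x ∈ (f i).coeff.support, 0 ≤ wt w x) :
    ∀ u ∈ (∏ i ∈ t, f i).coeff.support, 0 ≤ wt w u := by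
  classical
  induction t using Finset.induction_on with
  | empty =>
    intro u hu
    rw [Finset.prod_empty, one_def, coeff_single] at hu
    have := Finsupp.support_single_subset hu
    rw [Finset.mem_singleton] at this
    rw [this, wt_zero]
  | insert i t hi ih =>
    rw [Finset.prod_insert hi]
    have := k2_wtGE_mul w (hf i (Finset.mem_insert_self i t))
      (ih fun j hj => hf j (Finset.mem_insert_of_mem hj))
    simpa using this

/-- The support of a monomial `r X^m` is inside `{m}`. [folklore] -/
theorem k2_mem_support_single {m u : Fin 2 → ℤ} {r : ℂ} (hu : u ∈ (single m r).coeff.support) : u = m := by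
  rw [coeff_single] at hu
  exact Finset.mem_singleton.mp (Finsupp.support_single_subset hu)

/-- Coefficients of a shifted Laurent polynomial: `[X^{m+z}] (X^m f) = [X^z] f`. [folklore] -/
theorem k2_coeff_single_mul (m z : Fin 2 → ℤ) (f : AddMonoidAlgebra ℂ (Fin 2 → ℤ)) :
    (single m (1 : ℂ) * f).coeff (m + z) = f.coeff z := by
  rw [coeff_single_mul_apply, one_mul, neg_add_cancel_left]

/-- Support of a shifted Laurent polynomial. [folklore] -/
theorem k2_exists_of_mem_support_single_mul {m u : Fin 2 → ℤ} {f : AddMonoidAlgebra ℂ (Fin 2 → ℤ)}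
    (hu : u ∈ (single m (1 : ℂ) * f).coeff.support) : ∃ z ∈ f.coeff.support, u = m + z := by
  refine ⟨-m + u, ?_, by rw [add_neg_cancel_left]⟩
  rw [Finsupp.mem_support_iff] at hu ⊢
  rwa [coeff_single_mul_apply, one_mul] at hu

/-- A pushed univariate polynomial `P(X^E)` has support weights `≥ 0` when `⟨w, E⟩ > 0`. [folklore] -/
theorem k2_wtGE_eval₂ (w : Fin 2 → ℝ) (E : Fin 2 → ℤ) (hE : 0 < wt w E) (P : ℂ[X]) :
    ∀ u ∈ (Polynomial.eval₂ (singleZeroRingHom (R := ℂ) (M := Fin 2 → ℤ)) (single E (1 : ℂ)) P).coeff.support,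
      0 ≤ wt w u := by
  rw [k2_eval₂_eq_sum E P le_rfl]
  refine k2_wtGE_sum w _ _ fun i _ u hu => ?_
  rw [k2_mem_support_single hu, wt_zsmul]
  exact mul_nonneg (by exact_mod_cast (Int.natCast_nonneg i)) hE.le

/-! ## §3 Initial exponents -/

/-- **Initial exponent of a product with a unit-like factor.** If `v` is the `w`-initial exponent of `f`
(unique weight-minimal support point) and `g` has constant term `1` with every other exponent of positive
weight, then `v` is the `w`-initial exponent of `f g`, with the same coefficient. [folklore] -/
theorem k2_isInit_mul_unit (w : Fin 2 → ℝ) (f g : AddMonoidAlgebra ℂ (Fin 2 → ℤ)) (v : Fin 2 → ℤ)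
    (hg0 : g.coeff 0 = 1) (hgpos : ∀ z ∈ g.coeff.support, z ≠ 0 → 0 < wt w z)
    (hv : v ∈ f.coeff.support ∧ ∀ z ∈ f.coeff.support, z ≠ v → wt w v < wt w z) :
    (f * g).coeff v = f.coeff v ∧
      (v ∈ (f * g).coeff.support ∧ ∀ z ∈ (f * g).coeff.support, z ≠ v → wt w v < wt w z) := by
  classical
  -- weight comparison for pairs of exponents
  have hpair : ∀ x ∈ f.coeff.support, ∀ y ∈ g.coeff.support, wt w v ≤ wt w (x + y) ∧
      (wt w (x + y) = wt w v → x = v ∧ y = 0) := by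
    intro x hx y hy
    have hx' : wt w v ≤ wt w x := by
      by_cases hxv : x = v
      · rw [hxv]
      · exact (hv.2 x hx hxv).le
    have hy' : 0 ≤ wt w y := by
      by_cases hy0 : y = 0
      · rw [hy0, wt_zero]
      · exact (hgpos y hy hy0).le
    rw [wt_add]
    refine ⟨by linarith, fun heq => ⟨?_, ?_⟩⟩
    · by_contra hxv
      have := hv.2 x hx hxv
      linarith
    · by_contra hy0
      have := hgpos y hy hy0
      linarith
  have hcoeff : (f * g).coeff v = f.coeff v := by
    rw [coeff_mul]
    simp only [Finsupp.sum]
    rw [Finset.sum_eq_single_of_mem v hv.1]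
    · rw [Finset.sum_eq_single_of_mem (0 : Fin 2 → ℤ)]
      · rw [if_pos (add_zero v), hg0, mul_one]
      · rw [Finsupp.mem_support_iff, hg0]; exact one_ne_zero
      · intro y hy hy0
        rw [if_neg]
        intro h
        exact hy0 ((hpair v hv.1 y hy).2 (by rw [h])).2
    · intro x hx hxv
      refine Finset.sum_eq_zero fun y hy => ?_
      rw [if_neg]
      intro h
      exact hxv ((hpair x hx y hy).2 (by rw [h])).1
  refine ⟨hcoeff, ?_, ?_⟩
  · rw [Finsupp.mem_support_iff, hcoeff]
    exact Finsupp.mem_support_iff.mp hv.1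
  · intro u hu huv
    obtain ⟨x, hx, y, hy, rfl⟩ := k2_exists_add_of_mem_support_mul hu
    refine lt_of_le_of_ne (hpair x hx y hy).1 fun heq => huv ?_
    obtain ⟨rfl, rfl⟩ := (hpair x hx y hy).2 heq.symm
    rw [add_zero]

/-- **Initial exponents survive heavy perturbations.** If `f = g + h` where every exponent of `h` weighs
`≥ Ω`, and `v` with `⟨w,v⟩ < Ω` is the `w`-initial exponent of `f`, then it is the `w`-initial exponent of `g`,
with the same coefficient. [folklore] -/
theorem k2_isInit_of_heavy (w : Fin 2 → ℝ) (f g h : AddMonoidAlgebra ℂ (Fin 2 → ℤ)) (hf : f = g + h)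
    (Ω : ℝ) (hh : ∀ z ∈ h.coeff.support, Ω ≤ wt w z) (v : Fin 2 → ℤ) (hvΩ : wt w v < Ω)
    (hv : v ∈ f.coeff.support ∧ ∀ z ∈ f.coeff.support, z ≠ v → wt w v < wt w z) :
    g.coeff v = f.coeff v ∧
      (v ∈ g.coeff.support ∧ ∀ z ∈ g.coeff.support, z ≠ v → wt w v < wt w z) := by
  have hlow : ∀ z, wt w z < Ω → g.coeff z = f.coeff z := by
    intro z hz
    have hz0 : h.coeff z = 0 := by
      by_contra hne
      exact absurd (hh z (Finsupp.mem_support_iff.mpr hne)) (not_le.mpr hz)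
    rw [hf, coeff_add, Finsupp.add_apply, hz0, add_zero]
  refine ⟨hlow v hvΩ, ?_, ?_⟩
  · rw [Finsupp.mem_support_iff, hlow v hvΩ]
    exact Finsupp.mem_support_iff.mp hv.1
  · intro z hz hzv
    by_cases hzΩ : wt w z < Ω
    · refine hv.2 z ?_ hzv
      rw [Finsupp.mem_support_iff, ← hlow z hzΩ]
      exact Finsupp.mem_support_iff.mp hz
    · push Not at hzΩ
      exact lt_of_lt_of_le hvΩ hzΩ

/-- Initial exponents under a monomial shift. [folklore] -/
theorem k2_isInit_shift (w : Fin 2 → ℝ) (f : AddMonoidAlgebra ℂ (Fin 2 → ℤ)) (m v : Fin 2 → ℤ)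
    (hv : v ∈ f.coeff.support ∧ ∀ z ∈ f.coeff.support, z ≠ v → wt w v < wt w z) :
    (m + v) ∈ (single m (1 : ℂ) * f).coeff.support ∧
      ∀ z ∈ (single m (1 : ℂ) * f).coeff.support, z ≠ m + v → wt w (m + v) < wt w z := by
  refine ⟨?_, ?_⟩
  · rw [Finsupp.mem_support_iff, k2_coeff_single_mul]
    exact Finsupp.mem_support_iff.mp hv.1
  · intro z hz hne
    obtain ⟨z', hz', rfl⟩ := k2_exists_of_mem_support_single_mul hz
    rw [wt_add, wt_add]
    have := hv.2 z' hz' (fun h => hne (by rw [h]))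
    linarith

/-- Undoing a monomial shift. [folklore] -/
theorem k2_single_neg_mul_single_mul (m : Fin 2 → ℤ) (f : AddMonoidAlgebra ℂ (Fin 2 → ℤ)) :
    single (-m) (1 : ℂ) * (single m (1 : ℂ) * f) = f := by
  rw [← mul_assoc, single_mul_single, neg_add_cancel, mul_one, ← one_def, one_mul]

/-- Initial exponents are unchanged by a nonzero scalar. [folklore] -/
theorem k2_isInit_smul (w : Fin 2 → ℝ) (f : AddMonoidAlgebra ℂ (Fin 2 → ℤ)) {κ : ℂ} (hκ : κ ≠ 0)
    (v : Fin 2 → ℤ) (hv : v ∈ f.coeff.support ∧ ∀ z ∈ f.coeff.support, z ≠ v → wt w v < wt w z) :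
    v ∈ (κ • f).coeff.support ∧ ∀ z ∈ (κ • f).coeff.support, z ≠ v → wt w v < wt w z := by
  rw [coeff_smul, Finsupp.support_smul_eq hκ]
  exact hv

/-- The initial exponent is the unique candidate: a support point weighing at most the initial exponent IS
the initial exponent. [folklore] -/
theorem k2_eq_of_isInit (w : Fin 2 → ℝ) (f : AddMonoidAlgebra ℂ (Fin 2 → ℤ)) {v z : Fin 2 → ℤ}
    (hv : v ∈ f.coeff.support ∧ ∀ z ∈ f.coeff.support, z ≠ v → wt w v < wt w z)
    (hz : z ∈ f.coeff.support) (hle : wt w z ≤ wt w v) : v = z := by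
  by_contra hne
  exact absurd (hv.2 z hz (Ne.symm hne)) (not_lt.mpr hle)

end Summit.ValiantsHypothesis.ValiantsHypothesis.Theorems.NewtonTauWeakCorner

end
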